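import Literature.NumberTheory.Automorphic.UnitaryGroupDirectSum
import HarnessLib

/-!
# Direct sums on the group side of the see-saw — number-field carriers:
# `U(W₁)(𝔸) × U(W₂)(𝔸) → U(W₁ ⊕ W₂)(𝔸)` and the see-saw squares on adelic points

Topic `NumberTheory/Automorphic`; namespace `Literature.NumberTheory.Automorphic.UnitaryGroup` (sixth part of
`UnitaryGroupSymplecticEmbedding`; the number-field instances of `UnitaryGroupDirectSum`). Definitions and proved
lemmas only: **no named facts, 0 proof holes**.

The adelic carriers of this topic are `Fin`-indexed (`adelic F E c N J ≤ GL_N(𝔸_E)`, `adelicPair … ≤ GL_{N × M}(𝔸_E)`),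
so the direct sum `W = W₁ ⊕ W₂` of hermitian spaces of dimensions `M₁, M₂` is carried by `Fin (M₁ + M₂)` with Gram
matrix `J₁ ⊕ᶠ J₂ = finSum M₁ M₂ J₁ J₂` (`UnitaryGroupDirectSum`), and `V ⊗ W` by `Fin N × Fin (M₁ + M₂)`, relabelled to
`(Fin N × Fin M₁) ⊕ (Fin N × Fin M₂)` by `finProdSumEquiv N M₁ M₂` (§0) — the index on which the function side of the
see-saw (`𝒮(𝔸^{ι₁ ⊕ ι₂}) = 𝒮(𝔸^{ι₁}) ⊗̂ 𝒮(𝔸^{ι₂})`, `FiniteAdeleSchwartzBruhatDirectSum`) is written.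
* §0 (generic, any commutative ring): `finProdSumEquiv`; `kroneckerGL_reindexGL_right`; the Gram identity
  `reindex (T_V ⊗ (T₁ ⊕ᶠ T₂)) = (T_V ⊗ T₁) ⊕ (T_V ⊗ T₂)` (`reindex_kronecker_finSum`); the see-saw identity for
  restriction of scalars on `Fin`-indexed blocks (`resAut_kroneckerGL_blockDiagFin`) and on `pairToSymplectic`
  (`pairToSymplectic_dualPair_blockDiagFin`).
* §1 `adelicBlockDiag : U(J₁)(𝔸_F) × U(J₂)(𝔸_F) →* U(J₁ ⊕ᶠ J₂)(𝔸_F)` (continuous, injective), its rational form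
  `rationalBlockDiag`, and `adelicBlockDiag ∘ (toAdelic × toAdelic) = toAdelic ∘ rationalBlockDiag` (rational points go
  to rational points).
* §2 the see-saw squares on adelic points: for `g ∈ U(V)(𝔸)`, `u_j ∈ U(W_j)(𝔸)`,
  `spReindex e (toSp[V, W₁ ⊕ W₂] (a(g) b(u₁ ⊕ u₂))) = spSum (toSp[V, W₁] (a(g) b(u₁)), toSp[V, W₂] (a(g) b(u₂)))` as
  automorphisms of the common adelic symplectic space (`adelicPairToSymplectic_dualPair_adelicBlockDiag`), with the
  two one-sided squares (`…_adelicInl`: `U(V)` is diagonal in `Sp(𝕎₁) × Sp(𝕎₂)`; `…_adelicInr_adelicBlockDiag`: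
  `U(W₁) × U(W₂) → U(W₁ ⊕ W₂) → Sp(𝕎)` factors through `Sp(𝕎₁) × Sp(𝕎₂)`).
[folklore] throughout; see-saw context [Kudla1984, §1], [GelbartRogawski1991, §3.2].

References:
* [GelbartRogawski1991] S. Gelbart, J. Rogawski, *L-functions and Fourier–Jacobi coefficients for the unitary
  group U(3)*, Invent. Math. 105 (1991), §3.2.
* [Kudla1984] S. Kudla, *Seesaw dual reductive pairs*, Progr. Math. 46 (1984) 244–268, §1.
-/

set_option autoImplicit false

noncomputable section

open Matrix NumberField IsDedekindDomain
open scoped Kronecker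
open Literature.RepresentationTheory.HeisenbergGroup

namespace Literature.NumberTheory.Automorphic

namespace UnitaryGroup

/-! ## 0. Generic `Fin`-indexed complements -/

section GenericFin

variable {R S : Type*} [CommRing R] [CommRing S]

/-- **`Fin N × Fin (M₁ + M₂) ≃ (Fin N × Fin M₁) ⊕ (Fin N × Fin M₂)`**: `V ⊗ (W₁ ⊕ W₂) = (V ⊗ W₁) ⊕ (V ⊗ W₂)` on indices
(`finSumFinEquiv` on the second factor, then `Equiv.prodSumDistrib`). [folklore] -/
def finProdSumEquiv (N M₁ M₂ : ℕ) : Fin N × Fin (M₁ + M₂) ≃ (Fin N × Fin M₁) ⊕ (Fin N × Fin M₂) :=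
  ((Equiv.refl (Fin N)).prodCongr finSumFinEquiv).symm.trans (Equiv.prodSumDistrib (Fin N) (Fin M₁) (Fin M₂))

variable {n m m' : Type*} [Fintype n] [DecidableEq n] [Fintype m] [DecidableEq m] [Fintype m'] [DecidableEq m']

/-- **`g ⊗ reindex e w = reindex (1 × e) (g ⊗ w)`** in `GL`. [folklore] -/
theorem kroneckerGL_reindexGL_right (g : GL n S) (e : m ≃ m') (w : GL m S) :
    kroneckerGL (g, reindexGL e w) = reindexGL ((Equiv.refl n).prodCongr e) (kroneckerGL (g, w)) :=
  Units.ext (by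
    rw [coe_kroneckerGL, coe_reindexGL, coe_reindexGL, coe_kroneckerGL]
    exact Matrix.kroneckerMap_reindex_right _ e e _ _)

omit [Fintype n] [DecidableEq n] [Fintype m] [DecidableEq m] [Fintype m'] [DecidableEq m'] in
/-- `reindexW (e.trans e') = reindexW e ≫ reindexW e'`. [folklore] -/
theorem reindexW_trans (e : n ≃ m) (e' : m ≃ m') :
    reindexW R (e.trans e') = (reindexW R e).trans (reindexW R e') :=
  LinearEquiv.ext fun _ => rfl

omit [Fintype n] [DecidableEq n] [Fintype m] [DecidableEq m] in
/-- `reindexW e.symm = (reindexW e).symm`. [folklore] -/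
theorem reindexW_symm (e : n ≃ m) : reindexW R e.symm = (reindexW R e).symm :=
  LinearEquiv.ext fun _ => rfl

variable {N M₁ M₂ : ℕ}

/-- Gram matrices: **`reindex (T_V ⊗ (T₁ ⊕ᶠ T₂)) = (T_V ⊗ T₁) ⊕ (T_V ⊗ T₂)`** along `finProdSumEquiv` (the form on
`V ⊗ (W₁ ⊕ W₂)` is the orthogonal sum of the forms on `V ⊗ W_j`; so the two sides of the see-saw identity below live
in the SAME symplectic group). [folklore] -/
theorem reindex_kronecker_finSum (A : Matrix (Fin N) (Fin N) S) (B₁ : Matrix (Fin M₁) (Fin M₁) S)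
    (B₂ : Matrix (Fin M₂) (Fin M₂) S) :
    Matrix.reindex (finProdSumEquiv N M₁ M₂) (finProdSumEquiv N M₁ M₂) (A ⊗ₖ finSum M₁ M₂ B₁ B₂) =
      Matrix.fromBlocks (A ⊗ₖ B₁) 0 0 (A ⊗ₖ B₂) := by
  rw [← reindex_kronecker_fromBlocks_diag, finSum, Matrix.kroneckerMap_reindex_right, finProdSumEquiv]
  ext i j
  simp only [Matrix.reindex_apply, Matrix.submatrix_apply, Equiv.symm_trans_apply, Equiv.symm_symm,
    Equiv.symm_apply_apply]

/-- **The see-saw identity for restriction of scalars, `Fin`-indexed blocks**: for `g ∈ GL_N`, `u_j ∈ GL_{M_j}`,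
`e ∘ Res(g ⊗ (u₁ ⊕ᶠ u₂)) ∘ e⁻¹ = Res(g ⊗ u₁) ⊕ Res(g ⊗ u₂)` with `e = finProdSumEquiv`
(as automorphisms of `R^{(N × M₁) ⊕ (N × M₂)} × R^{(N × M₁) ⊕ (N × M₂)}`). [cite: Kudla1984, §1] -/
theorem IsQuadraticCoordinates.resAut_kroneckerGL_blockDiagFin {φ : R →+* S} {Ψ : (R × R) ≃+ S} {δ : S} {d : R}
    (h : IsQuadraticCoordinates φ Ψ δ d) (g : GL (Fin N) S) (u : GL (Fin M₁) S × GL (Fin M₂) S) :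
    ((reindexW R (finProdSumEquiv N M₁ M₂)).symm.trans
        (h.resAut (Fin N × Fin (M₁ + M₂)) (kroneckerGL (g, reindexGL finSumFinEquiv (blockDiagGL u))))).trans
        (reindexW R (finProdSumEquiv N M₁ M₂)) =
      spSumEquiv (h.resAut (Fin N × Fin M₁) (kroneckerGL (g, u.1))) (h.resAut (Fin N × Fin M₂) (kroneckerGL (g, u.2))) := by
  rw [← h.resAut_kroneckerGL_blockDiagGL, kroneckerGL_reindexGL_right, h.resAut_reindexGL, finProdSumEquiv,
    reindexW_trans, reindexW_symm]
  refine LinearEquiv.ext fun v => ?_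
  simp only [LinearEquiv.trans_apply, LinearEquiv.symm_trans_apply, LinearEquiv.symm_symm, LinearEquiv.symm_apply_apply]

/-- **The see-saw squares on `pairToSymplectic`, `Fin`-indexed** (`H_• = T_• ⊗ 1`, `W = W₁ ⊕ W₂` carried by
`Fin (M₁ + M₂)` with Gram matrix `T₁ ⊕ᶠ T₂`): for `G = g ⊗ (u₁ ⊕ᶠ u₂)`,
`spReindex e (pairToSymplectic[V, W] G) = spSum (pairToSymplectic[V, W₁] (g ⊗ u₁), pairToSymplectic[V, W₂] (g ⊗ u₂))` as
automorphisms of the common symplectic space. [cite: Kudla1984, §1] -/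
theorem IsQuadraticCoordinates.pairToSymplectic_dualPair_blockDiagFin {φ : R →+* S} {Ψ : (R × R) ≃+ S} {δ : S}
    {d : R} (h : IsQuadraticCoordinates φ Ψ δ d) {TV : Matrix (Fin N) (Fin N) R} {T₁ : Matrix (Fin M₁) (Fin M₁) R}
    {T₂ : Matrix (Fin M₂) (Fin M₂) R} (hV : TV.IsSymm) (h₁ : T₁.IsSymm) (h₂ : T₂.IsSymm) {σ : S →+* S}
    (hσφ : ∀ a, σ (φ a) = φ a) (hσδ : σ δ = -δ) {HV : Matrix (Fin N) (Fin N) S} {H₁ : Matrix (Fin M₁) (Fin M₁) S}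
    {H₂ : Matrix (Fin M₂) (Fin M₂) S} (hHV : HV = TV.map φ) (hH₁ : H₁ = T₁.map φ) (hH₂ : H₂ = T₂.map φ)
    (g : unitaryGroupOfForm σ HV) (u : unitaryGroupOfForm σ H₁ × unitaryGroupOfForm σ H₂) :
    ((spReindex (finProdSumEquiv N M₁ M₂) (TV ⊗ₖ finSum M₁ M₂ T₁ T₂)
          (h.pairToSymplectic hV (isSymm_finSum h₁ h₂) hσφ hσδ hHV
            (show finSum M₁ M₂ H₁ H₂ = (finSum M₁ M₂ T₁ T₂).map φ by rw [hH₁, hH₂, finSum_map])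
            (dualPair σ HV (finSum M₁ M₂ H₁ H₂) (g, blockDiagFin σ H₁ H₂ u))) :
        symplecticGroup (polar (Matrix.toLinearMap₂' R
          (Matrix.reindex (finProdSumEquiv N M₁ M₂) (finProdSumEquiv N M₁ M₂) (TV ⊗ₖ finSum M₁ M₂ T₁ T₂))))) :
        (((Fin N × Fin M₁) ⊕ (Fin N × Fin M₂) → R) × ((Fin N × Fin M₁) ⊕ (Fin N × Fin M₂) → R)) ≃ₗ[R]
          (((Fin N × Fin M₁) ⊕ (Fin N × Fin M₂) → R) × ((Fin N × Fin M₁) ⊕ (Fin N × Fin M₂) → R))) =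
      ((spSum (TV ⊗ₖ T₁) (TV ⊗ₖ T₂)
          (h.pairToSymplectic hV h₁ hσφ hσδ hHV hH₁ (dualPair σ HV H₁ (g, u.1)),
            h.pairToSymplectic hV h₂ hσφ hσδ hHV hH₂ (dualPair σ HV H₂ (g, u.2))) :
        symplecticGroup (polar (Matrix.toLinearMap₂' R (Matrix.fromBlocks (TV ⊗ₖ T₁) 0 0 (TV ⊗ₖ T₂))))) :
        (((Fin N × Fin M₁) ⊕ (Fin N × Fin M₂) → R) × ((Fin N × Fin M₁) ⊕ (Fin N × Fin M₂) → R)) ≃ₗ[R]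
          (((Fin N × Fin M₁) ⊕ (Fin N × Fin M₂) → R) × ((Fin N × Fin M₁) ⊕ (Fin N × Fin M₂) → R))) := by
  rw [coe_spReindex, coe_spSum]
  exact h.resAut_kroneckerGL_blockDiagFin (g : GL (Fin N) S) ((u.1 : GL (Fin M₁) S), (u.2 : GL (Fin M₂) S))

end GenericFin

/-! ## 1. `U(J₁)(𝔸_F) × U(J₂)(𝔸_F) →* U(J₁ ⊕ᶠ J₂)(𝔸_F)` and rational points -/

section Adelic

variable (F E : Type) [Field F] [NumberField F] [Field E] [NumberField E] [Algebra F E]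
variable (c : E ≃ₐ[F] E) (N M₁ M₂ : ℕ) (JV : Matrix (Fin N) (Fin N) E) (J₁ : Matrix (Fin M₁) (Fin M₁) E)
  (J₂ : Matrix (Fin M₂) (Fin M₂) E)

/-- `(J₁ ⊕ᶠ J₂) ⊗ 1 = (J₁ ⊗ 1) ⊕ᶠ (J₂ ⊗ 1)` over `𝔸_E`. [folklore] -/
theorem adelicForm_finSum :
    adelicForm E (M₁ + M₂) (finSum M₁ M₂ J₁ J₂) = finSum M₁ M₂ (adelicForm E M₁ J₁) (adelicForm E M₂ J₂) :=
  finSum_map _ _ _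

omit [NumberField F] in
/-- `U(J₁ ⊕ᶠ J₂)(𝔸_F) = U(c ⊗ 1, (J₁ ⊗ 1) ⊕ᶠ (J₂ ⊗ 1))` as subgroups of `GL_{M₁ + M₂}(𝔸_E)`. [folklore] -/
theorem adelic_finSum :
    adelic F E c (M₁ + M₂) (finSum M₁ M₂ J₁ J₂) =
      unitaryGroupOfForm (conjAdele F E c) (finSum M₁ M₂ (adelicForm E M₁ J₁) (adelicForm E M₂ J₂)) := by
  rw [adelic, adelicForm_finSum]

/-- **`U(J₁)(𝔸_F) × U(J₂)(𝔸_F) →* U(J₁ ⊕ᶠ J₂)(𝔸_F)`, `(u₁, u₂) ↦ u₁ ⊕ᶠ u₂`** — the adelic points of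
`U(W₁) × U(W₂) ⊂ U(W₁ ⊕ W₂)` (the small member of the see-saw pair `(U(V) × U(V), U(W₁ ⊕ W₂))`).
[cite: Kudla1984, §1] -/
def adelicBlockDiag :
    adelic F E c M₁ J₁ × adelic F E c M₂ J₂ →* adelic F E c (M₁ + M₂) (finSum M₁ M₂ J₁ J₂) :=
  (MulEquiv.subgroupCongr (adelic_finSum F E c M₁ M₂ J₁ J₂).symm).toMonoidHom.comp
    (blockDiagFin (conjAdele F E c) (adelicForm E M₁ J₁) (adelicForm E M₂ J₂))

omit [NumberField F] in
/-- underlying invertible matrix of `u₁ ⊕ᶠ u₂`: `reindex finSumFinEquiv finSumFinEquiv (diag(u₁, u₂))`. [folklore] -/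
@[simp] theorem coe_adelicBlockDiag (u : adelic F E c M₁ J₁ × adelic F E c M₂ J₂) :
    ((adelicBlockDiag F E c M₁ M₂ J₁ J₂ u : adelic F E c (M₁ + M₂) (finSum M₁ M₂ J₁ J₂)) :
        GL (Fin (M₁ + M₂)) (AdeleRing (𝓞 E) E)) =
      reindexGL finSumFinEquiv (blockDiagGL ((u.1 : GL (Fin M₁) (AdeleRing (𝓞 E) E)),
        (u.2 : GL (Fin M₂) (AdeleRing (𝓞 E) E)))) :=
  rfl

omit [NumberField F] in
/-- `adelicBlockDiag` is injective. [folklore] -/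
theorem adelicBlockDiag_injective : Function.Injective (adelicBlockDiag F E c M₁ M₂ J₁ J₂) :=
  fun _ _ huv => blockDiagFin_injective _ _ _
    ((MulEquiv.subgroupCongr (adelic_finSum F E c M₁ M₂ J₁ J₂).symm).injective huv)

omit [NumberField F] in
/-- **`adelicBlockDiag` is continuous.** [folklore] -/
theorem continuous_adelicBlockDiag : Continuous (adelicBlockDiag F E c M₁ M₂ J₁ J₂) :=
  Continuous.subtype_mk (continuous_subtype_val.comp (continuous_blockDiagFin _ _ _)) _

omit [NumberField F] in
/-- `u₁ ⊕ᶠ 1` and `1 ⊕ᶠ u₂` commute. [folklore] -/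
theorem commute_adelicBlockDiag_inl_inr (u₁ : adelic F E c M₁ J₁) (u₂ : adelic F E c M₂ J₂) :
    Commute (adelicBlockDiag F E c M₁ M₂ J₁ J₂ (u₁, 1)) (adelicBlockDiag F E c M₁ M₂ J₁ J₂ (1, u₂)) := by
  rw [Commute, SemiconjBy, ← map_mul, ← map_mul, Prod.mk_mul_mk, Prod.mk_mul_mk, one_mul, mul_one, one_mul, mul_one]

/-- **`U(J₁)(F) × U(J₂)(F) →* U(J₁ ⊕ᶠ J₂)(F)`** (rational points). [folklore] -/
def rationalBlockDiag :
    rational F E c M₁ J₁ × rational F E c M₂ J₂ →* rational F E c (M₁ + M₂) (finSum M₁ M₂ J₁ J₂) :=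
  blockDiagFin (c : E →+* E) J₁ J₂

omit [NumberField F] [NumberField E] in
/-- underlying invertible matrix of `rationalBlockDiag (γ₁, γ₂)`. [folklore] -/
@[simp] theorem coe_rationalBlockDiag (γ : rational F E c M₁ J₁ × rational F E c M₂ J₂) :
    ((rationalBlockDiag F E c M₁ M₂ J₁ J₂ γ : rational F E c (M₁ + M₂) (finSum M₁ M₂ J₁ J₂)) : GL (Fin (M₁ + M₂)) E) =
      reindexGL finSumFinEquiv (blockDiagGL ((γ.1 : GL (Fin M₁) E), (γ.2 : GL (Fin M₂) E))) :=
  rfl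

omit [NumberField F] in
/-- **Rational points go to rational points**: `(toAdelic γ₁) ⊕ᶠ (toAdelic γ₂) = toAdelic (γ₁ ⊕ᶠ γ₂)`. [folklore] -/
theorem adelicBlockDiag_toAdelic (γ₁ : rational F E c M₁ J₁) (γ₂ : rational F E c M₂ J₂) :
    adelicBlockDiag F E c M₁ M₂ J₁ J₂ (toAdelic F E c M₁ J₁ γ₁, toAdelic F E c M₂ J₂ γ₂) =
      toAdelic F E c (M₁ + M₂) (finSum M₁ M₂ J₁ J₂) (rationalBlockDiag F E c M₁ M₂ J₁ J₂ (γ₁, γ₂)) := by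
  refine Subtype.ext ?_
  show reindexGL finSumFinEquiv (blockDiagGL
      (Matrix.GeneralLinearGroup.map (algebraMap E (AdeleRing (𝓞 E) E)) (γ₁ : GL (Fin M₁) E),
        Matrix.GeneralLinearGroup.map (algebraMap E (AdeleRing (𝓞 E) E)) (γ₂ : GL (Fin M₂) E))) =
    Matrix.GeneralLinearGroup.map (algebraMap E (AdeleRing (𝓞 E) E))
      ((rationalBlockDiag F E c M₁ M₂ J₁ J₂ (γ₁, γ₂) : rational F E c (M₁ + M₂) (finSum M₁ M₂ J₁ J₂)) :
        GL (Fin (M₁ + M₂)) E)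
  exact (map_coe_blockDiagFin (algebraMap E (AdeleRing (𝓞 E) E)) J₁ J₂ (γ₁, γ₂)).symm

omit [NumberField F] in
/-- `(toAdelic γ₁) ⊕ᶠ (toAdelic γ₂) ∈ range toAdelic`. [folklore] -/
theorem adelicBlockDiag_toAdelic_mem_range (γ₁ : rational F E c M₁ J₁) (γ₂ : rational F E c M₂ J₂) :
    adelicBlockDiag F E c M₁ M₂ J₁ J₂ (toAdelic F E c M₁ J₁ γ₁, toAdelic F E c M₂ J₂ γ₂) ∈
      (toAdelic F E c (M₁ + M₂) (finSum M₁ M₂ J₁ J₂)).range :=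
  ⟨rationalBlockDiag F E c M₁ M₂ J₁ J₂ (γ₁, γ₂), (adelicBlockDiag_toAdelic F E c M₁ M₂ J₁ J₂ γ₁ γ₂).symm⟩

/-! ## 2. The see-saw squares on adelic points -/

variable {JV J₁ J₂}

/-- **The see-saw squares on adelic points** (`J_V = T_V ⊗ 1`, `J_j = T_j ⊗ 1`, `T`'s symmetric over `F`): for
`g ∈ U(J_V)(𝔸_F)`, `u_j ∈ U(J_j)(𝔸_F)`,
`spReindex e (toSp[V, W₁ ⊕ W₂] (g ⊗ (u₁ ⊕ᶠ u₂))) = spSum (toSp[V, W₁] (g ⊗ u₁), toSp[V, W₂] (g ⊗ u₂))`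
as automorphisms of `𝔸_F^{(N × M₁) ⊕ (N × M₂)} × 𝔸_F^{(N × M₁) ⊕ (N × M₂)}` (`e = finProdSumEquiv N M₁ M₂`; the two
symplectic groups have Gram matrices `reindex e e (T_V ⊗ (T₁ ⊕ᶠ T₂))` and `(T_V ⊗ T₁) ⊕ (T_V ⊗ T₂)` over `𝔸_F`, equal
by `reindex_kronecker_finSum`). [cite: Kudla1984, §1] -/
theorem adelicPairToSymplectic_dualPair_adelicBlockDiag [Algebra.IsQuadraticExtension F E] {δ : E}
    (hcδ : c δ = -δ) (hδ : δ ≠ 0) {d : F} (hd : δ * δ = algebraMap F E d) {TV : Matrix (Fin N) (Fin N) F}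
    {T₁ : Matrix (Fin M₁) (Fin M₁) F} {T₂ : Matrix (Fin M₂) (Fin M₂) F} (hV : TV.IsSymm) (h₁ : T₁.IsSymm)
    (h₂ : T₂.IsSymm) (hJV : JV = TV.map (algebraMap F E)) (hJ₁ : J₁ = T₁.map (algebraMap F E))
    (hJ₂ : J₂ = T₂.map (algebraMap F E)) (g : adelic F E c N JV) (u : adelic F E c M₁ J₁ × adelic F E c M₂ J₂) :
    ((spReindex (finProdSumEquiv N M₁ M₂)
          (TV.map (algebraMap F (AdeleRing (𝓞 F) F)) ⊗ₖ (finSum M₁ M₂ T₁ T₂).map (algebraMap F (AdeleRing (𝓞 F) F)))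
          (adelicPairToSymplectic F E c N (M₁ + M₂) hcδ hδ hd hV (isSymm_finSum h₁ h₂) hJV
            (show finSum M₁ M₂ J₁ J₂ = (finSum M₁ M₂ T₁ T₂).map (algebraMap F E) by rw [hJ₁, hJ₂, finSum_map])
            (dualPair (conjAdele F E c) (adelicForm E N JV) (adelicForm E (M₁ + M₂) (finSum M₁ M₂ J₁ J₂))
              (g, adelicBlockDiag F E c M₁ M₂ J₁ J₂ u))) :
        symplecticGroup (polar (Matrix.toLinearMap₂' (AdeleRing (𝓞 F) F)
          (Matrix.reindex (finProdSumEquiv N M₁ M₂) (finProdSumEquiv N M₁ M₂)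
            (TV.map (algebraMap F (AdeleRing (𝓞 F) F)) ⊗ₖ
              (finSum M₁ M₂ T₁ T₂).map (algebraMap F (AdeleRing (𝓞 F) F))))))) :
        (((Fin N × Fin M₁) ⊕ (Fin N × Fin M₂) → AdeleRing (𝓞 F) F) ×
            ((Fin N × Fin M₁) ⊕ (Fin N × Fin M₂) → AdeleRing (𝓞 F) F)) ≃ₗ[AdeleRing (𝓞 F) F]
          (((Fin N × Fin M₁) ⊕ (Fin N × Fin M₂) → AdeleRing (𝓞 F) F) ×
            ((Fin N × Fin M₁) ⊕ (Fin N × Fin M₂) → AdeleRing (𝓞 F) F))) =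
      ((spSum (TV.map (algebraMap F (AdeleRing (𝓞 F) F)) ⊗ₖ T₁.map (algebraMap F (AdeleRing (𝓞 F) F)))
          (TV.map (algebraMap F (AdeleRing (𝓞 F) F)) ⊗ₖ T₂.map (algebraMap F (AdeleRing (𝓞 F) F)))
          (adelicPairToSymplectic F E c N M₁ hcδ hδ hd hV h₁ hJV hJ₁
              (dualPair (conjAdele F E c) (adelicForm E N JV) (adelicForm E M₁ J₁) (g, u.1)),
            adelicPairToSymplectic F E c N M₂ hcδ hδ hd hV h₂ hJV hJ₂
              (dualPair (conjAdele F E c) (adelicForm E N JV) (adelicForm E M₂ J₂) (g, u.2))) :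
        symplecticGroup (polar (Matrix.toLinearMap₂' (AdeleRing (𝓞 F) F)
          (Matrix.fromBlocks
            (TV.map (algebraMap F (AdeleRing (𝓞 F) F)) ⊗ₖ T₁.map (algebraMap F (AdeleRing (𝓞 F) F))) 0 0
            (TV.map (algebraMap F (AdeleRing (𝓞 F) F)) ⊗ₖ T₂.map (algebraMap F (AdeleRing (𝓞 F) F))))))) :
        (((Fin N × Fin M₁) ⊕ (Fin N × Fin M₂) → AdeleRing (𝓞 F) F) ×
            ((Fin N × Fin M₁) ⊕ (Fin N × Fin M₂) → AdeleRing (𝓞 F) F)) ≃ₗ[AdeleRing (𝓞 F) F]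
          (((Fin N × Fin M₁) ⊕ (Fin N × Fin M₂) → AdeleRing (𝓞 F) F) ×
            ((Fin N × Fin M₁) ⊕ (Fin N × Fin M₂) → AdeleRing (𝓞 F) F))) := by
  rw [coe_spReindex, coe_spSum]
  exact (isQuadraticCoordinates_adele E c hcδ hδ hd).resAut_kroneckerGL_blockDiagFin
    (g : GL (Fin N) (AdeleRing (𝓞 E) E))
    ((u.1 : GL (Fin M₁) (AdeleRing (𝓞 E) E)), (u.2 : GL (Fin M₂) (AdeleRing (𝓞 E) E)))

omit [NumberField F] in
/-- `a(g) b(w) = dualPair (g, w)` in `G₁(𝔸_F)`. [folklore] -/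
theorem adelicInl_mul_adelicInr {M : ℕ} {JW : Matrix (Fin M) (Fin M) E} (g : adelic F E c N JV) (w : adelic F E c M JW) :
    adelicInl F E c N M JV JW g * adelicInr F E c N M JV JW w =
      dualPair (conjAdele F E c) (adelicForm E N JV) (adelicForm E M JW) (g, w) := by
  show dualPair (conjAdele F E c) (adelicForm E N JV) (adelicForm E M JW) (g, 1) *
      dualPair (conjAdele F E c) (adelicForm E N JV) (adelicForm E M JW) (1, w) = _
  rw [← map_mul, Prod.mk_mul_mk, mul_one, one_mul]

/-- **The `U(V)`-side square**: `U(V)(𝔸)` acts diagonally — `spReindex e (toSp[V, W₁ ⊕ W₂] (a g)) =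
spSum (toSp[V, W₁] (a g), toSp[V, W₂] (a g))` as automorphisms. [cite: Kudla1984, §1] -/
theorem adelicPairToSymplectic_adelicInl_finSum [Algebra.IsQuadraticExtension F E] {δ : E}
    (hcδ : c δ = -δ) (hδ : δ ≠ 0) {d : F} (hd : δ * δ = algebraMap F E d) {TV : Matrix (Fin N) (Fin N) F}
    {T₁ : Matrix (Fin M₁) (Fin M₁) F} {T₂ : Matrix (Fin M₂) (Fin M₂) F} (hV : TV.IsSymm) (h₁ : T₁.IsSymm)
    (h₂ : T₂.IsSymm) (hJV : JV = TV.map (algebraMap F E)) (hJ₁ : J₁ = T₁.map (algebraMap F E))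
    (hJ₂ : J₂ = T₂.map (algebraMap F E)) (g : adelic F E c N JV) :
    ((spReindex (finProdSumEquiv N M₁ M₂)
          (TV.map (algebraMap F (AdeleRing (𝓞 F) F)) ⊗ₖ (finSum M₁ M₂ T₁ T₂).map (algebraMap F (AdeleRing (𝓞 F) F)))
          (adelicPairToSymplectic F E c N (M₁ + M₂) hcδ hδ hd hV (isSymm_finSum h₁ h₂) hJV
            (show finSum M₁ M₂ J₁ J₂ = (finSum M₁ M₂ T₁ T₂).map (algebraMap F E) by rw [hJ₁, hJ₂, finSum_map])
            (adelicInl F E c N (M₁ + M₂) JV (finSum M₁ M₂ J₁ J₂) g)) :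
        symplecticGroup (polar (Matrix.toLinearMap₂' (AdeleRing (𝓞 F) F)
          (Matrix.reindex (finProdSumEquiv N M₁ M₂) (finProdSumEquiv N M₁ M₂)
            (TV.map (algebraMap F (AdeleRing (𝓞 F) F)) ⊗ₖ
              (finSum M₁ M₂ T₁ T₂).map (algebraMap F (AdeleRing (𝓞 F) F))))))) :
        (((Fin N × Fin M₁) ⊕ (Fin N × Fin M₂) → AdeleRing (𝓞 F) F) ×
            ((Fin N × Fin M₁) ⊕ (Fin N × Fin M₂) → AdeleRing (𝓞 F) F)) ≃ₗ[AdeleRing (𝓞 F) F]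
          (((Fin N × Fin M₁) ⊕ (Fin N × Fin M₂) → AdeleRing (𝓞 F) F) ×
            ((Fin N × Fin M₁) ⊕ (Fin N × Fin M₂) → AdeleRing (𝓞 F) F))) =
      ((spSum (TV.map (algebraMap F (AdeleRing (𝓞 F) F)) ⊗ₖ T₁.map (algebraMap F (AdeleRing (𝓞 F) F)))
          (TV.map (algebraMap F (AdeleRing (𝓞 F) F)) ⊗ₖ T₂.map (algebraMap F (AdeleRing (𝓞 F) F)))
          (adelicPairToSymplectic F E c N M₁ hcδ hδ hd hV h₁ hJV hJ₁ (adelicInl F E c N M₁ JV J₁ g),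
            adelicPairToSymplectic F E c N M₂ hcδ hδ hd hV h₂ hJV hJ₂ (adelicInl F E c N M₂ JV J₂ g)) :
        symplecticGroup (polar (Matrix.toLinearMap₂' (AdeleRing (𝓞 F) F)
          (Matrix.fromBlocks
            (TV.map (algebraMap F (AdeleRing (𝓞 F) F)) ⊗ₖ T₁.map (algebraMap F (AdeleRing (𝓞 F) F))) 0 0
            (TV.map (algebraMap F (AdeleRing (𝓞 F) F)) ⊗ₖ T₂.map (algebraMap F (AdeleRing (𝓞 F) F))))))) :
        (((Fin N × Fin M₁) ⊕ (Fin N × Fin M₂) → AdeleRing (𝓞 F) F) ×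
            ((Fin N × Fin M₁) ⊕ (Fin N × Fin M₂) → AdeleRing (𝓞 F) F)) ≃ₗ[AdeleRing (𝓞 F) F]
          (((Fin N × Fin M₁) ⊕ (Fin N × Fin M₂) → AdeleRing (𝓞 F) F) ×
            ((Fin N × Fin M₁) ⊕ (Fin N × Fin M₂) → AdeleRing (𝓞 F) F))) := by
  have h1 : adelicInl F E c N (M₁ + M₂) JV (finSum M₁ M₂ J₁ J₂) g =
      dualPair (conjAdele F E c) (adelicForm E N JV) (adelicForm E (M₁ + M₂) (finSum M₁ M₂ J₁ J₂))
        (g, adelicBlockDiag F E c M₁ M₂ J₁ J₂ 1) := by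
    rw [map_one]; rfl
  have h2 : ∀ (M : ℕ) (JW : Matrix (Fin M) (Fin M) E), adelicInl F E c N M JV JW g =
      dualPair (conjAdele F E c) (adelicForm E N JV) (adelicForm E M JW) (g, 1) := fun M JW => rfl
  rw [h1, h2 M₁ J₁, h2 M₂ J₂]
  exact adelicPairToSymplectic_dualPair_adelicBlockDiag F E c N M₁ M₂ hcδ hδ hd hV h₁ h₂ hJV hJ₁ hJ₂ g (1, 1)

/-- **The `U(W₁) × U(W₂)`-side square**: `U(W₁)(𝔸) × U(W₂)(𝔸) → U(W₁ ⊕ W₂)(𝔸) → Sp(𝕎)` factors through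
`Sp(𝕎₁) × Sp(𝕎₂) → Sp(𝕎₁ ⊕ 𝕎₂)` — `spReindex e (toSp[V, W₁ ⊕ W₂] (b (u₁ ⊕ᶠ u₂))) = spSum (toSp[V, W₁] (b u₁), toSp[V, W₂] (b u₂))`
as automorphisms. [cite: Kudla1984, §1] -/
theorem adelicPairToSymplectic_adelicInr_adelicBlockDiag [Algebra.IsQuadraticExtension F E] {δ : E}
    (hcδ : c δ = -δ) (hδ : δ ≠ 0) {d : F} (hd : δ * δ = algebraMap F E d) {TV : Matrix (Fin N) (Fin N) F}
    {T₁ : Matrix (Fin M₁) (Fin M₁) F} {T₂ : Matrix (Fin M₂) (Fin M₂) F} (hV : TV.IsSymm) (h₁ : T₁.IsSymm)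
    (h₂ : T₂.IsSymm) (hJV : JV = TV.map (algebraMap F E)) (hJ₁ : J₁ = T₁.map (algebraMap F E))
    (hJ₂ : J₂ = T₂.map (algebraMap F E)) (u : adelic F E c M₁ J₁ × adelic F E c M₂ J₂) :
    ((spReindex (finProdSumEquiv N M₁ M₂)
          (TV.map (algebraMap F (AdeleRing (𝓞 F) F)) ⊗ₖ (finSum M₁ M₂ T₁ T₂).map (algebraMap F (AdeleRing (𝓞 F) F)))
          (adelicPairToSymplectic F E c N (M₁ + M₂) hcδ hδ hd hV (isSymm_finSum h₁ h₂) hJV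
            (show finSum M₁ M₂ J₁ J₂ = (finSum M₁ M₂ T₁ T₂).map (algebraMap F E) by rw [hJ₁, hJ₂, finSum_map])
            (adelicInr F E c N (M₁ + M₂) JV (finSum M₁ M₂ J₁ J₂) (adelicBlockDiag F E c M₁ M₂ J₁ J₂ u))) :
        symplecticGroup (polar (Matrix.toLinearMap₂' (AdeleRing (𝓞 F) F)
          (Matrix.reindex (finProdSumEquiv N M₁ M₂) (finProdSumEquiv N M₁ M₂)
            (TV.map (algebraMap F (AdeleRing (𝓞 F) F)) ⊗ₖ
              (finSum M₁ M₂ T₁ T₂).map (algebraMap F (AdeleRing (𝓞 F) F))))))) :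
        (((Fin N × Fin M₁) ⊕ (Fin N × Fin M₂) → AdeleRing (𝓞 F) F) ×
            ((Fin N × Fin M₁) ⊕ (Fin N × Fin M₂) → AdeleRing (𝓞 F) F)) ≃ₗ[AdeleRing (𝓞 F) F]
          (((Fin N × Fin M₁) ⊕ (Fin N × Fin M₂) → AdeleRing (𝓞 F) F) ×
            ((Fin N × Fin M₁) ⊕ (Fin N × Fin M₂) → AdeleRing (𝓞 F) F))) =
      ((spSum (TV.map (algebraMap F (AdeleRing (𝓞 F) F)) ⊗ₖ T₁.map (algebraMap F (AdeleRing (𝓞 F) F)))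
          (TV.map (algebraMap F (AdeleRing (𝓞 F) F)) ⊗ₖ T₂.map (algebraMap F (AdeleRing (𝓞 F) F)))
          (adelicPairToSymplectic F E c N M₁ hcδ hδ hd hV h₁ hJV hJ₁ (adelicInr F E c N M₁ JV J₁ u.1),
            adelicPairToSymplectic F E c N M₂ hcδ hδ hd hV h₂ hJV hJ₂ (adelicInr F E c N M₂ JV J₂ u.2)) :
        symplecticGroup (polar (Matrix.toLinearMap₂' (AdeleRing (𝓞 F) F)
          (Matrix.fromBlocks
            (TV.map (algebraMap F (AdeleRing (𝓞 F) F)) ⊗ₖ T₁.map (algebraMap F (AdeleRing (𝓞 F) F))) 0 0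
            (TV.map (algebraMap F (AdeleRing (𝓞 F) F)) ⊗ₖ T₂.map (algebraMap F (AdeleRing (𝓞 F) F))))))) :
        (((Fin N × Fin M₁) ⊕ (Fin N × Fin M₂) → AdeleRing (𝓞 F) F) ×
            ((Fin N × Fin M₁) ⊕ (Fin N × Fin M₂) → AdeleRing (𝓞 F) F)) ≃ₗ[AdeleRing (𝓞 F) F]
          (((Fin N × Fin M₁) ⊕ (Fin N × Fin M₂) → AdeleRing (𝓞 F) F) ×
            ((Fin N × Fin M₁) ⊕ (Fin N × Fin M₂) → AdeleRing (𝓞 F) F))) := by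
  have h1 : ∀ (M : ℕ) (JW : Matrix (Fin M) (Fin M) E) (w : adelic F E c M JW), adelicInr F E c N M JV JW w =
      dualPair (conjAdele F E c) (adelicForm E N JV) (adelicForm E M JW) (1, w) := fun M JW w => rfl
  rw [h1, h1 M₁ J₁, h1 M₂ J₂]
  exact adelicPairToSymplectic_dualPair_adelicBlockDiag F E c N M₁ M₂ hcδ hδ hd hV h₁ h₂ hJV hJ₁ hJ₂ 1 u

omit [NumberField F] in
/-- **`b ∘ adelicBlockDiag` is continuous** (`U(W₁)(𝔸) × U(W₂)(𝔸) → G₁(𝔸)`). [folklore] -/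
theorem continuous_adelicInr_adelicBlockDiag :
    Continuous fun u : adelic F E c M₁ J₁ × adelic F E c M₂ J₂ =>
      adelicInr F E c N (M₁ + M₂) JV (finSum M₁ M₂ J₁ J₂) (adelicBlockDiag F E c M₁ M₂ J₁ J₂ u) :=
  (continuous_adelicInr F E c N (M₁ + M₂) JV (finSum M₁ M₂ J₁ J₂)).comp (continuous_adelicBlockDiag F E c M₁ M₂ J₁ J₂)

end Adelic

end UnitaryGroup

end Literature.NumberTheory.Automorphic

end
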